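import Literature.NumberTheory.LFunctions.DedekindZetaThetaProofs
import HarnessLib

/-!
# The continued class partial zeta functions, explicitly; `(s − 1) ζ_K(s)` is entire

Topic `Literature/NumberTheory/LFunctions`, sibling proofs file (D-0014) of `DedekindZeta.lean`,
continuing Hecke's proof of the continuation of `ζ_K` as formalised in `DedekindZetaMellin.lean`,
`DedekindZetaMellinProofs.lean` (Neukirch, *Algebraic Number Theory*, Ch. VII (5.5)–(5.11) (i),
through Mathlib's `WeakFEPair` = the Mellin principle (1.4)) and `DedekindZetaThetaProofs.lean`
(the theta transformation formula `thetaIdeal_inv_holds`). Everything here is PROVED. It is the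
common base of the discharges of the functional equation `Literature.NumberTheory.LFunctions.completedDedekindZeta_one_sub` and of
the finite order of `(s − 1) ζ_K(s)` (`Literature.NumberTheory.LFunctions.dedekindZetaCont_finiteOrder`, `DedekindZetaFiniteOrder.lean`),
the two Selberg-class axioms of `ζ_K` still open in `RHGeneralizedRHDedekindProofs.lean`.

## Content

`DedekindZetaMellinProofs.exists_classSum_continuation` continues each class partial zeta function
`ζ(𝔎, s) = ∑_{𝔟 ∈ 𝔎} 𝔑(𝔟)^{-s}` to `ℂ ∖ {1}`, but only existentially, which hides the polar part
and the growth. We make the same construction explicit: with `P = heckePair` of an integral ideal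
`J = classRep 𝔎` representing `𝔎⁻¹`, Mathlib's entire `P.Λ₀` and
`P.Λ(s') = P.Λ₀(s') − 1/s' − ε/(1/2 − s')`, Neukirch's (5.9)
`Λ_J(s/2) = c_K A(s/2) w 𝔑(J)^{-s} ζ(𝔎, s)` (`heckePair_Λ_eq_classSum`) gives
`ζ(𝔎, s) = B(s) Λ_J(s/2)` with the entire `B(s) = c_K⁻¹ w⁻¹ 𝔑(J)^s A(s/2)⁻¹`
(`classFrontFactor`); the pole of `Λ_J` at `s' = 0` is cancelled by the zero of `A⁻¹` (as in the
tree: `invGammaFactorC₀`, `classFrontFactor₀`), and the pole at `s' = 1/2` is the term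
`B(s) · 2ε/(s − 1)`:

* `classSumCont 𝔎 s = B(s) (Λ₀(s/2) − 2ε/(1 − s)) − B₀(s)` — holomorphic on `ℂ ∖ {1}`
  (`differentiableOn_classSumCont`), `= ∑_{𝔟 ∈ 𝔎} 𝔑(𝔟)^{-s}` for `Re(s) > 1`
  (`classSumCont_eq_tsum`; Neukirch VII (5.9));
* `classSumEntire 𝔎 s = B(s) ((s − 1) Λ₀(s/2) + 2ε) − (s − 1) B₀(s)` — entire
  (`differentiable_classSumEntire`), `= (s − 1) · classSumCont 𝔎 s` off `s = 1`;
* `isDedekindZetaContinuation_sum_classSumCont`, `dedekindZetaCont_eq_sum_classSumCont` —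
  `ζ_K(s) = ∑_𝔎 classSumCont 𝔎 s` for `s ≠ 1`, for the tree's `dedekindZetaCont` (uniqueness of the
  continuation, `IsDedekindZetaContinuation.eqOn_dedekindZetaCont_holds`; Neukirch VII (5.11) (i));
* `sub_one_mul_dedekindZetaCont_eq_sum_classSumEntire`, `exists_entire_eq_sub_one_mul_dedekindZetaCont`
  — `(s − 1) ζ_K(s)` is the restriction of an explicit entire function (Neukirch VII (5.11) (ii):
  the only pole of `ζ_K` is simple, at `s = 1`); `exists_entire_eq_sub_one_mul_dedekindZetaCont'`
  feeds in `thetaIdeal_inv_holds`.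

All statements but the last take the theta transformation formula as a hypothesis
`(hinv : thetaIdeal_inv K)`, as `DedekindZetaMellin*.lean` do. (The residue at `s = 1`,
`Literature.NumberTheory.LFunctions.tendsto_sub_one_mul_dedekindZetaCont_holds`, is already in the tree, `DedekindZetaNonvanishing.lean`,
by Landau's half-plane continuation; it is not re-derived here.)

## References

* J. Neukirch, *Algebraic Number Theory*, Grundlehren 322, Springer 1999, Ch. VII (5.9)–(5.11).
  [NeukirchANT1999]
* Mathlib: `NumberTheory.LSeries.AbstractFuncEq` (`WeakFEPair`, D. Loeffler).
-/

noncomputable section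

open scoped NumberField nonZeroDivisors
open NumberField NumberField.InfinitePlace NumberField.Units Complex Filter Topology Set

namespace Literature.NumberTheory.LFunctions.NumberField

variable (K : Type*) [Field K] [NumberField K]

/-! ## The explicit continuation of the class partial zeta functions -/

/-- Hecke's normalising constant `c_K = 2^{-(r₁+r₂-1)} · n · (2^{-r₂} n R_K)⁻¹` of the unfolded
Mellin transform (Neukirch VII (5.5): the factors `2^{-(r-1)}` of the unit-cube parametrisation,
`n = [K:ℚ]` of `dt/t`, and the covolume `2^{-r₂} n R` of the unit lattice), as in
`heckePair_Λ_eq_classSum`. [cite: NeukirchANT1999, Ch. VII (5.5)] -/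
def heckeCst : ℝ :=
  (2 ^ rank K)⁻¹ * Module.finrank ℚ K * (2⁻¹ ^ nrComplexPlaces K * Module.finrank ℚ K * regulator K)⁻¹

/-- The Euler factor at infinity in Hecke's normalisation,
`A(z) = ∏_w (π e_w)^{-e_w z} Γ(e_w z)` (`e_w = 1, 2` at real, complex places), so that
`A(s/2) = Γ_ℝ(s)^{r₁} (2^{-1} Γ_ℂ(s))^{r₂}` (Neukirch VII (5.3): `L_∞(𝔎,s)`; (4.3)).
[cite: NeukirchANT1999, Ch. VII (5.3)] -/
def gammaFactorC (z : ℂ) : ℂ :=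
  ∏ w : InfinitePlace K, (((1 / (Real.pi * mult w) : ℝ)) : ℂ) ^ ((mult w : ℂ) * z) *
    Complex.Gamma ((mult w : ℂ) * z)

/-- A distinguished infinite place (there is one). [folklore] -/
def somePlace : InfinitePlace K := Classical.arbitrary (InfinitePlace K)

open scoped Classical in
/-- `A(z)⁻¹ / z` made entire: `E₀(z) = ∏_{w ≠ w₁} (π e_w)^{e_w z} Γ(e_w z)⁻¹ ·
(π e₁)^{e₁ z} e₁ Γ(e₁ z + 1)⁻¹` (`Γ(e₁ z)⁻¹ = e₁ z Γ(e₁ z + 1)⁻¹` absorbs the division by `z`),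
used to remove the pole of `Λ` at `0` against the zero of `A⁻¹` (Neukirch VII (5.11) (i):
`ζ_K(0) = -hR/w` is finite). [folklore] -/
def invGammaFactorC₀ (z : ℂ) : ℂ :=
  (∏ w ∈ Finset.univ.erase (somePlace K),
      ((((1 / (Real.pi * mult w) : ℝ)) : ℂ) ^ (-((mult w : ℂ) * z)) * (Complex.Gamma ((mult w : ℂ) * z))⁻¹)) *
    ((((1 / (Real.pi * mult (somePlace K)) : ℝ)) : ℂ) ^ (-((mult (somePlace K) : ℂ) * z)) *
      (mult (somePlace K) : ℂ) * (Complex.Gamma ((mult (somePlace K) : ℂ) * z + 1))⁻¹)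

/-- An integral ideal representing the inverse class `C⁻¹` (`ClassGroup.mk0` is surjective).
[folklore] -/
def classRep (C : ClassGroup (𝓞 K)) : (Ideal (𝓞 K))⁰ :=
  Classical.choose (ClassGroup.mk0_surjective C⁻¹)

/-- `J_C` represents `C⁻¹`. [folklore] -/
theorem mk0_classRep (C : ClassGroup (𝓞 K)) : ClassGroup.mk0 (classRep K C) = C⁻¹ :=
  Classical.choose_spec (ClassGroup.mk0_surjective C⁻¹)

variable {K}

/-- The weak FE-pair of the representative `J_C` of `C⁻¹` (`heckePair`), given the theta
transformation formula. [folklore] -/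
def classPair (hinv : thetaIdeal_inv K) (C : ClassGroup (𝓞 K)) : WeakFEPair ℂ :=
  heckePair K hinv _ (coeIdeal_ne_zero_of_mem_nonZeroDivisors (classRep K C))

variable (K) in
/-- The entire factor `B(s) = c_K⁻¹ w⁻¹ 𝔑(J_C)^s A(s/2)⁻¹` in front of `Λ_{J_C}(s/2)`. [folklore] -/
def classFrontFactor (C : ClassGroup (𝓞 K)) (s : ℂ) : ℂ :=
  ((heckeCst K : ℂ))⁻¹ * ((torsionOrder K : ℂ))⁻¹ *
    (Ideal.absNorm ((classRep K C : (Ideal (𝓞 K))⁰) : Ideal (𝓞 K)) : ℂ) ^ s * (gammaFactorC K (s / 2))⁻¹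

variable (K) in
/-- The entire correction `B₀(s) = c_K⁻¹ w⁻¹ 𝔑(J_C)^s E₀(s/2)` (`= B(s)/(s/2)` off `s = 0`).
[folklore] -/
def classFrontFactor₀ (C : ClassGroup (𝓞 K)) (s : ℂ) : ℂ :=
  ((heckeCst K : ℂ))⁻¹ * ((torsionOrder K : ℂ))⁻¹ *
    (Ideal.absNorm ((classRep K C : (Ideal (𝓞 K))⁰) : Ideal (𝓞 K)) : ℂ) ^ s * invGammaFactorC₀ K (s / 2)

/-- **The continued class partial zeta function** `ζ(C, s)` (Neukirch VII (5.9)–(5.11) (i)), as an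
explicit function holomorphic on `ℂ ∖ {1}`:
`D_C(s) = B(s) (Λ₀(s/2) − 2ε/(1 − s)) − B₀(s)` with Mathlib's entire `Λ₀` of the pair
`classPair`; equals `∑_{𝔟 ∈ C} 𝔑(𝔟)^{-s}` for `Re(s) > 1` (`classSumCont_eq_tsum`).
[cite: NeukirchANT1999, Ch. VII (5.9)] -/
def classSumCont (hinv : thetaIdeal_inv K) (C : ClassGroup (𝓞 K)) (s : ℂ) : ℂ :=
  classFrontFactor K C s *
      ((classPair hinv C).Λ₀ (s / 2) - (classPair hinv C).ε / (((1 / 2 : ℝ) : ℂ) - s / 2)) -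
    classFrontFactor₀ K C s

/-- **`(s − 1) ζ(C, s)` is entire**: `E_C(s) = B(s) ((s − 1) Λ₀(s/2) + 2ε) − (s − 1) B₀(s)`
(Neukirch VII (5.11) (ii): the only pole of `Z(𝔎, s)` off `s = 0` is simple at `s = 1`).
[cite: NeukirchANT1999, Ch. VII (5.10), (5.11)] -/
def classSumEntire (hinv : thetaIdeal_inv K) (C : ClassGroup (𝓞 K)) (s : ℂ) : ℂ :=
  classFrontFactor K C s * ((s - 1) * (classPair hinv C).Λ₀ (s / 2) + 2 * (classPair hinv C).ε) -
    (s - 1) * classFrontFactor₀ K C s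

/-! ### Holomorphy -/

omit [NumberField K] in
/-- `(π e_w)⁻¹ ≠ 0`. [folklore] -/
theorem one_div_pi_mul_mult_ne_zero (w : InfinitePlace K) :
    (((1 / (Real.pi * mult w) : ℝ)) : ℂ) ≠ 0 := by
  have : (0 : ℝ) < mult w := Nat.cast_pos.mpr mult_pos
  exact_mod_cast (by positivity : (1 / (Real.pi * mult w) : ℝ) ≠ 0)

variable (K) in
/-- `A⁻¹` is entire (`1/Γ` is entire). [folklore] -/
theorem differentiable_inv_gammaFactorC' : Differentiable ℂ fun z ↦ (gammaFactorC K z)⁻¹ := by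
  unfold gammaFactorC
  exact differentiable_inv_gammaFactorC

variable (K) in
/-- `A(z)⁻¹ = ∏_w (π e_w)^{e_w z} Γ(e_w z)⁻¹`. [folklore] -/
theorem inv_gammaFactorC_eq (z : ℂ) : (gammaFactorC K z)⁻¹ = ∏ w : InfinitePlace K,
    ((((1 / (Real.pi * mult w) : ℝ)) : ℂ) ^ (-((mult w : ℂ) * z)) * (Complex.Gamma ((mult w : ℂ) * z))⁻¹) := by
  unfold gammaFactorC
  rw [← Finset.prod_inv_distrib]
  refine Finset.prod_congr rfl fun w _ ↦ ?_
  rw [mul_inv, Complex.cpow_neg]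

variable (K) in
open scoped Classical in
/-- `E₀` is entire. [folklore] -/
theorem differentiable_invGammaFactorC₀ : Differentiable ℂ (invGammaFactorC₀ K) := by
  unfold invGammaFactorC₀
  refine Differentiable.mul ?_ ?_
  · have hd : ∀ w ∈ Finset.univ.erase (somePlace K), Differentiable ℂ (fun z : ℂ ↦
        (((1 / (Real.pi * mult w) : ℝ)) : ℂ) ^ (-((mult w : ℂ) * z)) * (Complex.Gamma ((mult w : ℂ) * z))⁻¹) := by
      intro w _
      refine Differentiable.mul ?_ ?_
      · exact Differentiable.const_cpow (differentiable_id.const_mul _).neg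
          (Or.inl (one_div_pi_mul_mult_ne_zero w))
      · exact Complex.differentiable_one_div_Gamma.comp (differentiable_id.const_mul _)
    have key := Differentiable.finsetProd hd
    have heq2 : (∏ w ∈ Finset.univ.erase (somePlace K), fun z : ℂ ↦
        (((1 / (Real.pi * mult w) : ℝ)) : ℂ) ^ (-((mult w : ℂ) * z)) * (Complex.Gamma ((mult w : ℂ) * z))⁻¹) =
        fun z ↦ ∏ w ∈ Finset.univ.erase (somePlace K),
          ((((1 / (Real.pi * mult w) : ℝ)) : ℂ) ^ (-((mult w : ℂ) * z)) * (Complex.Gamma ((mult w : ℂ) * z))⁻¹) := by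
      funext z; exact Finset.prod_apply z _ _
    rw [heq2] at key
    exact key
  · refine Differentiable.mul (Differentiable.mul ?_ (differentiable_const _)) ?_
    · exact Differentiable.const_cpow (differentiable_id.const_mul _).neg
        (Or.inl (one_div_pi_mul_mult_ne_zero _))
    · exact Complex.differentiable_one_div_Gamma.comp ((differentiable_id.const_mul _).add_const _)

variable (K) in
open scoped Classical in
/-- `E₀(z) = A(z)⁻¹ / z` for `z ≠ 0`. [folklore] -/
theorem invGammaFactorC₀_eq {z : ℂ} (hz : z ≠ 0) : invGammaFactorC₀ K z = (gammaFactorC K z)⁻¹ / z := by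
  rw [inv_gammaFactorC_eq, ← Finset.prod_erase_mul _ _ (Finset.mem_univ (somePlace K)), invGammaFactorC₀,
    mul_div_assoc]
  congr 1
  rw [inv_Gamma_eq_mul_inv_Gamma_add_one (mult (somePlace K) : ℂ) z]
  field_simp

/-- `c_K > 0` (`R_K > 0`, Mathlib `regulator_pos`). [folklore] -/
theorem heckeCst_pos : 0 < heckeCst K := by
  unfold heckeCst
  have := regulator_pos K
  have : (0 : ℝ) < Module.finrank ℚ K := Nat.cast_pos.mpr Module.finrank_pos
  positivity

/-- `𝔑(J_C) ≠ 0`. [folklore] -/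
theorem absNorm_classRep_ne_zero (C : ClassGroup (𝓞 K)) :
    (Ideal.absNorm ((classRep K C : (Ideal (𝓞 K))⁰) : Ideal (𝓞 K)) : ℂ) ≠ 0 := by
  exact_mod_cast (Ideal.absNorm_pos_of_nonZeroDivisors (classRep K C)).ne'

variable (K) in
/-- `B` is entire. [folklore] -/
theorem differentiable_classFrontFactor (C : ClassGroup (𝓞 K)) :
    Differentiable ℂ (classFrontFactor K C) := by
  unfold classFrontFactor
  refine Differentiable.mul (Differentiable.mul (differentiable_const _) ?_) ?_
  · exact Differentiable.const_cpow differentiable_id (Or.inl (absNorm_classRep_ne_zero C))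
  · exact (differentiable_inv_gammaFactorC' K).comp (differentiable_id.div_const 2)

variable (K) in
/-- `B₀` is entire. [folklore] -/
theorem differentiable_classFrontFactor₀ (C : ClassGroup (𝓞 K)) :
    Differentiable ℂ (classFrontFactor₀ K C) := by
  unfold classFrontFactor₀
  refine Differentiable.mul (Differentiable.mul (differentiable_const _) ?_) ?_
  · exact Differentiable.const_cpow differentiable_id (Or.inl (absNorm_classRep_ne_zero C))
  · exact (differentiable_invGammaFactorC₀ K).comp (differentiable_id.div_const 2)

variable (K) in
/-- `B₀(s) = B(s) / (s/2)` for `s ≠ 0`. [folklore] -/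
theorem classFrontFactor₀_eq (C : ClassGroup (𝓞 K)) {s : ℂ} (hs : s ≠ 0) :
    classFrontFactor₀ K C s = classFrontFactor K C s * (1 / (s / 2)) := by
  unfold classFrontFactor₀ classFrontFactor
  rw [invGammaFactorC₀_eq K (div_ne_zero hs two_ne_zero)]
  ring

/-- **`E_C` is entire.** [cite: NeukirchANT1999, Ch. VII (5.10)] -/
theorem differentiable_classSumEntire (hinv : thetaIdeal_inv K) (C : ClassGroup (𝓞 K)) :
    Differentiable ℂ (classSumEntire hinv C) := by
  unfold classSumEntire
  refine Differentiable.sub (Differentiable.mul (differentiable_classFrontFactor K C) ?_) ?_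
  · refine Differentiable.add (Differentiable.mul (differentiable_id.sub_const 1) ?_)
      (differentiable_const _)
    exact (classPair hinv C).differentiable_Λ₀.comp (differentiable_id.div_const 2)
  · exact (differentiable_id.sub_const 1).mul (differentiable_classFrontFactor₀ K C)

/-- **`D_C` is holomorphic off `s = 1`.** [cite: NeukirchANT1999, Ch. VII (5.9)] -/
theorem differentiableOn_classSumCont (hinv : thetaIdeal_inv K) (C : ClassGroup (𝓞 K)) :
    DifferentiableOn ℂ (classSumCont hinv C) {1}ᶜ := by
  intro s hs
  have hs1 : s ≠ 1 := hs
  refine DifferentiableAt.differentiableWithinAt ?_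
  unfold classSumCont
  refine DifferentiableAt.sub (DifferentiableAt.mul (differentiable_classFrontFactor K C s)
    (DifferentiableAt.sub ?_ ?_)) (differentiable_classFrontFactor₀ K C s)
  · exact ((classPair hinv C).differentiable_Λ₀.comp (differentiable_id.div_const 2)) s
  · refine DifferentiableAt.div (differentiableAt_const _) ?_ ?_
    · exact (differentiableAt_const _).sub (differentiableAt_id.div_const 2)
    · intro h
      apply hs1
      have : s / 2 = ((1 / 2 : ℝ) : ℂ) := (sub_eq_zero.mp h).symm
      have := congr_arg (fun z : ℂ ↦ 2 * z) this
      push_cast at this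
      linear_combination this

/-- `E_C(s) = (s − 1) D_C(s)` for `s ≠ 1`. [folklore] -/
theorem classSumEntire_eq_sub_one_mul (hinv : thetaIdeal_inv K) (C : ClassGroup (𝓞 K)) {s : ℂ}
    (hs : s ≠ 1) : classSumEntire hinv C s = (s - 1) * classSumCont hinv C s := by
  unfold classSumEntire classSumCont
  have h : (((1 / 2 : ℝ) : ℂ) - s / 2) ≠ 0 := by
    intro h
    apply hs
    have : s / 2 = ((1 / 2 : ℝ) : ℂ) := (sub_eq_zero.mp h).symm
    have := congr_arg (fun z : ℂ ↦ 2 * z) this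
    push_cast at this
    linear_combination this
  have h2 : (s - 1) * ((classPair hinv C).ε / (((1 / 2 : ℝ) : ℂ) - s / 2)) = -(2 * (classPair hinv C).ε) := by
    have h1s : (1 : ℂ) - s ≠ 0 := sub_ne_zero.mpr (Ne.symm hs)
    have h3 : (((1 / 2 : ℝ) : ℂ) - s / 2) = (1 - s) / 2 := by push_cast; ring
    rw [h3]
    field_simp
    ring
  linear_combination classFrontFactor K C s * h2


/-! ### The identification with the class sum for `Re(s) > 1` -/

/-- `A(s/2) ≠ 0` for `Re(s) > 0`. [folklore] -/
theorem gammaFactorC_ne_zero {z : ℂ} (hz : 0 < z.re) : gammaFactorC K z ≠ 0 := by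
  unfold gammaFactorC
  refine Finset.prod_ne_zero_iff.mpr fun w _ ↦ mul_ne_zero ?_ ?_
  · exact fun h ↦ one_div_pi_mul_mult_ne_zero w ((Complex.cpow_eq_zero_iff _ _).mp h).1
  · refine Complex.Gamma_ne_zero_of_re_pos ?_
    have : (0 : ℝ) < mult w := Nat.cast_pos.mpr mult_pos
    simp only [Complex.mul_re, Complex.natCast_re, Complex.natCast_im, zero_mul, sub_zero]
    positivity

/-- **`D_C(s) = ∑_{𝔟 ∈ C} 𝔑(𝔟)^{-s}` for `Re(s) > 1`** (Neukirch VII (5.9) with (5.4):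
`Λ_{J_C}(s/2) = c_K A(s/2) w 𝔑(J_C)^{-s} ∑_{𝔟 ∈ C} 𝔑(𝔟)^{-s}`, `heckePair_Λ_eq_classSum`, and
`Λ = Λ₀ − 1/s − ε/(1/2 − s)`). [cite: NeukirchANT1999, Ch. VII (5.9)] -/
theorem classSumCont_eq_tsum (hinv : thetaIdeal_inv K) (C : ClassGroup (𝓞 K)) {s : ℂ} (hs : 1 < s.re) :
    classSumCont hinv C s =
      ∑' I : {I : (Ideal (𝓞 K))⁰ // ClassGroup.mk0 I = C}, ((Ideal.absNorm I.1.1 : ℕ) : ℂ) ^ (-s) := by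
  have hs0 : s ≠ 0 := fun h ↦ by rw [h, Complex.zero_re] at hs; linarith
  set P := classPair hinv C with hP
  have hΛ : P.Λ (s / 2) = ((heckeCst K : ℝ) : ℂ) * gammaFactorC K (s / 2) * (torsionOrder K : ℂ) *
      (Ideal.absNorm ((classRep K C : (Ideal (𝓞 K))⁰) : Ideal (𝓞 K)) : ℂ) ^ (-s) *
      ∑' I : {I : (Ideal (𝓞 K))⁰ // ClassGroup.mk0 I = C}, ((Ideal.absNorm I.1.1 : ℕ) : ℂ) ^ (-s) :=
    heckePair_Λ_eq_classSum hinv C (classRep K C) (mk0_classRep K C) hs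
  have hA0 : gammaFactorC K (s / 2) ≠ 0 :=
    gammaFactorC_ne_zero (by simp only [Complex.div_ofNat_re]; linarith)
  have hNs0 : (Ideal.absNorm ((classRep K C : (Ideal (𝓞 K))⁰) : Ideal (𝓞 K)) : ℂ) ^ s ≠ 0 :=
    fun h ↦ absNorm_classRep_ne_zero C ((Complex.cpow_eq_zero_iff _ _).mp h).1
  have hCst0 : ((heckeCst K : ℝ) : ℂ) ≠ 0 := Complex.ofReal_ne_zero.mpr (heckeCst_pos (K := K)).ne'
  have hw0 : (torsionOrder K : ℂ) ≠ 0 := by exact_mod_cast torsionOrder_ne_zero K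
  have hΛdef : P.Λ (s / 2) = P.Λ₀ (s / 2) - (1 / (s / 2)) • P.f₀ - (P.ε / ((P.k : ℂ) - s / 2)) • P.g₀ := rfl
  have hf0 : P.f₀ = 1 := rfl
  have hg0 : P.g₀ = 1 := rfl
  have hk : (P.k : ℂ) = ((1 / 2 : ℝ) : ℂ) := rfl
  rw [hf0, hg0, hk, smul_eq_mul, smul_eq_mul, mul_one, mul_one] at hΛdef
  unfold classSumCont
  rw [classFrontFactor₀_eq K C hs0, ← hP]
  calc classFrontFactor K C s * (P.Λ₀ (s / 2) - P.ε / (((1 / 2 : ℝ) : ℂ) - s / 2)) -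
        classFrontFactor K C s * (1 / (s / 2))
      = classFrontFactor K C s * P.Λ (s / 2) := by rw [hΛdef]; ring
    _ = ∑' I : {I : (Ideal (𝓞 K))⁰ // ClassGroup.mk0 I = C}, ((Ideal.absNorm I.1.1 : ℕ) : ℂ) ^ (-s) := by
        rw [hΛ]
        unfold classFrontFactor
        rw [Complex.cpow_neg]
        field_simp

/-! ### The continuation of `ζ_K` and the entire function `(s − 1) ζ_K(s)` -/

/-- `s ↦ ∑_C D_C(s)` is a continuation of `ζ_K` to `ℂ ∖ {1}` (Neukirch VII (5.10) Corollary,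
(5.11) (i): `ζ_K = ∑_𝔎 ζ(𝔎, ·)`, `dedekindZeta_eq_sum_classSum`).
[cite: NeukirchANT1999, Ch. VII (5.11) (i)] -/
theorem isDedekindZetaContinuation_sum_classSumCont (hinv : thetaIdeal_inv K) :
    IsDedekindZetaContinuation K (fun s ↦ ∑ C : ClassGroup (𝓞 K), classSumCont hinv C s) := by
  refine ⟨DifferentiableOn.fun_sum fun C _ ↦ differentiableOn_classSumCont hinv C, fun s hs ↦ ?_⟩
  have hs' : 1 < s.re := hs
  show ∑ C : ClassGroup (𝓞 K), classSumCont hinv C s = dedekindZeta K s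
  rw [dedekindZeta_eq_sum_classSum hs']
  exact Finset.sum_congr rfl fun C _ ↦ classSumCont_eq_tsum hinv C hs'

/-- Hence (uniqueness of the continuation, `IsDedekindZetaContinuation.eqOn_dedekindZetaCont_holds`)
`ζ_K(s) = ∑_C D_C(s)` for `s ≠ 1`, for the tree's `dedekindZetaCont`. [folklore] -/
theorem dedekindZetaCont_eq_sum_classSumCont (hinv : thetaIdeal_inv K) {s : ℂ} (hs : s ≠ 1) :
    dedekindZetaCont K s = ∑ C : ClassGroup (𝓞 K), classSumCont hinv C s :=
  ((IsDedekindZetaContinuation.eqOn_dedekindZetaCont_holds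
    (isDedekindZetaContinuation_sum_classSumCont hinv)) (Set.mem_compl_singleton_iff.mpr hs)).symm

/-- **`(s − 1) ζ_K(s) = ∑_C E_C(s)` for `s ≠ 1`**, with the entire functions `E_C`. [folklore] -/
theorem sub_one_mul_dedekindZetaCont_eq_sum_classSumEntire (hinv : thetaIdeal_inv K) {s : ℂ}
    (hs : s ≠ 1) :
    (s - 1) * dedekindZetaCont K s = ∑ C : ClassGroup (𝓞 K), classSumEntire hinv C s := by
  rw [dedekindZetaCont_eq_sum_classSumCont hinv hs, Finset.mul_sum]
  exact Finset.sum_congr rfl fun C _ ↦ (classSumEntire_eq_sub_one_mul hinv C hs).symm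

variable (K) in
/-- **`(s − 1) ζ_K(s)` is entire** (Neukirch VII (5.11) (ii): `ζ_K` has exactly one pole, simple,
at `s = 1`): there is an entire `E` with `E(s) = (s − 1) ζ_K(s)` off `s = 1`; given the theta
transformation formula. [cite: NeukirchANT1999, Ch. VII (5.11) (ii)] -/
theorem exists_entire_eq_sub_one_mul_dedekindZetaCont (hinv : thetaIdeal_inv K) :
    ∃ E : ℂ → ℂ, Differentiable ℂ E ∧ ∀ s : ℂ, s ≠ 1 → E s = (s - 1) * dedekindZetaCont K s :=
  ⟨fun s ↦ ∑ C : ClassGroup (𝓞 K), classSumEntire hinv C s,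
    Differentiable.fun_sum fun C _ ↦ differentiable_classSumEntire hinv C,
    fun _ hs ↦ (sub_one_mul_dedekindZetaCont_eq_sum_classSumEntire hinv hs).symm⟩

variable (K) in
/-- `(s − 1) ζ_K(s)` is the restriction of an entire function — unconditionally, by the theta
transformation formula `thetaIdeal_inv_holds` (`DedekindZetaThetaProofs.lean`).
[cite: NeukirchANT1999, Ch. VII (5.11) (ii)] -/
theorem exists_entire_eq_sub_one_mul_dedekindZetaCont' :
    ∃ E : ℂ → ℂ, Differentiable ℂ E ∧ ∀ s : ℂ, s ≠ 1 → E s = (s - 1) * dedekindZetaCont K s :=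
  exists_entire_eq_sub_one_mul_dedekindZetaCont K (thetaIdeal_inv_holds K)

end NumberField

end Literature.NumberTheory.LFunctions
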